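import Mathlib.Analysis.SpecialFunctions.Log.Basic
import Mathlib.Analysis.SpecialFunctions.Pow.Real
import Mathlib.Topology.Algebra.Order.Floor
import HarnessLib

/-!
# Pineau–Vicol 2026, Theorem 1.7 by compactness: the arithmetic of factors and angles

Analysis/FluidPDE proofs file (elementary real analysis only; no definitions, no named facts).
In Chae–Wolf's indirect compactness argument for ROTATED discretely self-similar solutions
(factors `c_n ↓ 1`, speeds `α_n`), a `(c_n, α_n)`-RDSS field is invariant under the twisted
scalings by every power `c_n^k` composed with the rotation by `2α_n k log c_n` about the axis.
To make the limit `μ`-self-similar for a prescribed `μ ≥ 1` one needs exponents `k_n` with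
`c_n^{k_n} → μ` (`tendsto_pow_natFloor_log`), and — for the limit to carry a prescribed rotation,
or none — a control of the angles `2α_n k_n log c_n` modulo `2π`. When `|α_n| → ∞` but
`α_n log c_n → 0` (the regime `c < c₂^{1/(1+α²)}` of Theorem 1.7 (ii)), the angle step
`θ_n = 2α_n log c_n` per unit of `k` tends to `0` while the cost in `log c_n^{k}` of `2π/θ_n` steps
is `π/α_n → 0`, so the exponents can be TUNED to kill the rotation in the limit
(`exists_step_near_multiple`, `exists_tuned_exponents`).

## References

* B. Pineau, V. Vicol, arXiv:2607.09619 (2026): Theorem 1.7 and Remark 1.5. [PineauVicol2026]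
* D. Chae, J. Wolf, Comm. PDE 42 (2017) 1359–1374 = arXiv:1610.09464, §3 Step 2. [ChaeWolf2017RemovingDSS]
-/

noncomputable section

open Filter Set
open scoped Topology

namespace Literature.Analysis.FluidPDE

namespace PineauVicol2026

/-- **Powers of factors tending to `1` approximate every `μ ≥ 1`.** If `c_n > 1`, `c_n → 1`,
then `c_n ^ ⌊log μ / log c_n⌋₊ → μ` for every `μ ≥ 1` (`log` of the power lies in
`(log μ − log c_n, log μ]`). [cite: ChaeWolf2017RemovingDSS, §3 Step 2 ("λ_j^{k_j} → μ")] -/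
theorem tendsto_pow_natFloor_log {c : ℕ → ℝ} (hc : ∀ n, 1 < c n) (hlim : Tendsto c atTop (𝓝 1))
    {μ : ℝ} (hμ : 1 ≤ μ) :
    Tendsto (fun n => c n ^ ⌊Real.log μ / Real.log (c n)⌋₊) atTop (𝓝 μ) := by
  have hlog0 : ∀ n, 0 < Real.log (c n) := fun n => Real.log_pos (hc n)
  have hμ0 : 0 < μ := one_pos.trans_le hμ
  have hlogμ : 0 ≤ Real.log μ := Real.log_nonneg hμ
  -- `log c_n → 0`
  have hloglim : Tendsto (fun n => Real.log (c n)) atTop (𝓝 0) := by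
    have h := (Real.continuousAt_log one_ne_zero).tendsto.comp hlim
    rwa [Function.comp_def, Real.log_one] at h
  -- the exponents times `log c_n` tend to `log μ`
  set k : ℕ → ℕ := fun n => ⌊Real.log μ / Real.log (c n)⌋₊ with hk
  have hupper : ∀ n, (k n : ℝ) * Real.log (c n) ≤ Real.log μ := fun n => by
    have h1 : (k n : ℝ) ≤ Real.log μ / Real.log (c n) := Nat.floor_le (div_nonneg hlogμ (hlog0 n).le)
    rwa [le_div_iff₀ (hlog0 n)] at h1
  have hlower : ∀ n, Real.log μ - Real.log (c n) ≤ (k n : ℝ) * Real.log (c n) := fun n => by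
    have h1 : Real.log μ / Real.log (c n) < (k n : ℝ) + 1 := Nat.lt_floor_add_one _
    rw [div_lt_iff₀ (hlog0 n)] at h1
    linarith
  have hklim : Tendsto (fun n => (k n : ℝ) * Real.log (c n)) atTop (𝓝 (Real.log μ)) := by
    refine tendsto_of_tendsto_of_tendsto_of_le_of_le ?_ tendsto_const_nhds hlower hupper
    have h := (tendsto_const_nhds (x := Real.log μ)).sub hloglim
    rwa [sub_zero] at h
  -- exponentiate
  have hexp := (Real.continuous_exp.tendsto _).comp hklim
  rw [Real.exp_log hμ0] at hexp
  refine hexp.congr fun n => ?_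
  rw [Function.comp_apply, ← Real.log_pow, Real.exp_log (pow_pos (zero_lt_one.trans (hc n)) _)]

/-- **One tuning step.** For a non-zero step `θ` and any base angle `A` there are `j : ℕ` steps,
`j|θ| ≤ 2π`, and an integer `m` with `|A + jθ − 2πm| ≤ |θ|`. [folklore] -/
theorem exists_step_near_multiple {θ : ℝ} (hθ : θ ≠ 0) (A : ℝ) :
    ∃ (j : ℕ) (m : ℤ), (j : ℝ) * |θ| ≤ 2 * Real.pi ∧ |A + j * θ - 2 * Real.pi * m| ≤ |θ| := by
  have h2π : 0 < 2 * Real.pi := by positivity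
  rcases lt_or_gt_of_ne hθ with hneg | hpos
  · -- `θ < 0`: step down from the gap `g = A - 2π⌊A/2π⌋ ∈ [0, 2π)`
    set m : ℤ := ⌊A / (2 * Real.pi)⌋ with hm
    set g : ℝ := A - 2 * Real.pi * m with hg
    have hg0 : 0 ≤ g := by
      have h1 : (m : ℝ) ≤ A / (2 * Real.pi) := Int.floor_le _
      rw [le_div_iff₀ h2π] at h1
      rw [hg]; linarith
    have hg2 : g < 2 * Real.pi := by
      have h1 : A / (2 * Real.pi) < (m : ℝ) + 1 := Int.lt_floor_add_one _
      rw [div_lt_iff₀ h2π] at h1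
      rw [hg]; linarith
    have hθ' : 0 < |θ| := abs_pos.2 hθ
    set j : ℕ := ⌊g / |θ|⌋₊ with hj
    have hj1 : (j : ℝ) * |θ| ≤ g := by
      have h1 : (j : ℝ) ≤ g / |θ| := Nat.floor_le (div_nonneg hg0 hθ'.le)
      rwa [le_div_iff₀ hθ'] at h1
    have hj2 : g < ((j : ℝ) + 1) * |θ| := by
      have h1 : g / |θ| < (j : ℝ) + 1 := Nat.lt_floor_add_one _
      rwa [div_lt_iff₀ hθ'] at h1
    refine ⟨j, m, by linarith, ?_⟩
    rw [abs_of_neg hneg] at hj1 hj2 ⊢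
    rw [abs_le]
    constructor <;> nlinarith [hg]
  · -- `θ > 0`: step up to the gap `g = 2π⌈A/2π⌉ - A ∈ [0, 2π)`
    set m : ℤ := ⌈A / (2 * Real.pi)⌉ with hm
    set g : ℝ := 2 * Real.pi * m - A with hg
    have hg0 : 0 ≤ g := by
      have h1 : A / (2 * Real.pi) ≤ (m : ℝ) := Int.le_ceil _
      rw [div_le_iff₀ h2π] at h1
      rw [hg]; linarith
    have hg2 : g < 2 * Real.pi := by
      have h1 : (m : ℝ) < A / (2 * Real.pi) + 1 := Int.ceil_lt_add_one _
      have h2 : ((m : ℝ) - 1) * (2 * Real.pi) < A := by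
        have h3 : (m : ℝ) - 1 < A / (2 * Real.pi) := by linarith
        rwa [lt_div_iff₀ h2π] at h3
      rw [hg]; nlinarith [Real.pi_pos]
    have hθ' : 0 < |θ| := abs_pos.2 hθ
    set j : ℕ := ⌊g / |θ|⌋₊ with hj
    have hj1 : (j : ℝ) * |θ| ≤ g := by
      have h1 : (j : ℝ) ≤ g / |θ| := Nat.floor_le (div_nonneg hg0 hθ'.le)
      rwa [le_div_iff₀ hθ'] at h1
    have hj2 : g < ((j : ℝ) + 1) * |θ| := by
      have h1 : g / |θ| < (j : ℝ) + 1 := Nat.lt_floor_add_one _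
      rwa [div_lt_iff₀ hθ'] at h1
    refine ⟨j, m, by linarith, ?_⟩
    rw [abs_of_pos hpos] at hj1 hj2 ⊢
    rw [abs_le]
    constructor <;> nlinarith [hg]


/-- **Tuned exponents (the regime of Theorem 1.7 (ii)).** Let `c_n > 1`, `c_n → 1`, and let the
speeds satisfy `|α_n| → ∞` while `α_n log c_n → 0`. Then for every `μ ≥ 1` there are exponents
`k_n : ℕ` and integers `m_n` with `c_n^{k_n} → μ` and `2α_n log(c_n^{k_n}) − 2π m_n → 0`: the twisted
scalings by `c_n^{k_n}` have factors tending to `μ` and rotation angles tending to `0` modulo `2π`.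
(Start from `k⁰_n = ⌊log μ / log c_n⌋`; the angle step `θ_n = 2α_n log c_n → 0` per unit of `k`,
and `≤ 2π/|θ_n|` extra steps, costing `≤ π/|α_n| → 0` in `log`, bring the angle within `|θ_n|` of
`2πℤ`.) [cite: PineauVicol2026, Theorem 1.7 (ii) (the exponent `1/(1+α²)`); ChaeWolf2017RemovingDSS, §3 Step 2] -/
theorem exists_tuned_exponents {c α : ℕ → ℝ} (hc : ∀ n, 1 < c n) (hlim : Tendsto c atTop (𝓝 1))
    (hα : Tendsto (fun n => |α n|) atTop atTop)
    (hαc : Tendsto (fun n => α n * Real.log (c n)) atTop (𝓝 0)) {μ : ℝ} (hμ : 1 ≤ μ) :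
    ∃ (k : ℕ → ℕ) (m : ℕ → ℤ), Tendsto (fun n => c n ^ k n) atTop (𝓝 μ) ∧
      Tendsto (fun n => α n * (2 * Real.log (c n ^ k n)) - 2 * Real.pi * m n) atTop (𝓝 0) := by
  have hc0 : ∀ n, 0 < c n := fun n => zero_lt_one.trans (hc n)
  have hlog0 : ∀ n, 0 < Real.log (c n) := fun n => Real.log_pos (hc n)
  set k₀ : ℕ → ℕ := fun n => ⌊Real.log μ / Real.log (c n)⌋₊ with hk₀
  set θ : ℕ → ℝ := fun n => α n * (2 * Real.log (c n)) with hθ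
  -- one tuning step for each `n` (trivial when `θ n = 0`)
  have hstep : ∀ n, ∃ (j : ℕ) (m : ℤ), (j : ℝ) * |θ n| ≤ 2 * Real.pi ∧
      |(k₀ n : ℝ) * θ n + j * θ n - 2 * Real.pi * m| ≤ |θ n| := by
    intro n
    by_cases h0 : θ n = 0
    · refine ⟨0, 0, ?_, ?_⟩
      · rw [Nat.cast_zero, zero_mul]; positivity
      · simp [h0]
    · exact exists_step_near_multiple h0 _
  choose j m hj hm using hstep
  refine ⟨fun n => k₀ n + j n, m, ?_, ?_⟩
  · -- factors: `c^{k₀} → μ` and `c^{j} → 1`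
    have h1 : Tendsto (fun n => c n ^ k₀ n) atTop (𝓝 μ) := tendsto_pow_natFloor_log hc hlim hμ
    have h2 : Tendsto (fun n => c n ^ j n) atTop (𝓝 1) := by
      -- `0 ≤ j_n log c_n ≤ π / |α_n|` eventually
      have hb : ∀ᶠ n in atTop, (j n : ℝ) * Real.log (c n) ≤ Real.pi / |α n| := by
        filter_upwards [hα.eventually_ge_atTop 1] with n hn
        have hαn : 0 < |α n| := one_pos.trans_le hn
        rw [le_div_iff₀ hαn]
        have e : |θ n| = 2 * |α n| * Real.log (c n) := by
          rw [hθ]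
          simp only
          rw [abs_mul, abs_of_pos (mul_pos two_pos (hlog0 n))]
          ring
        have := hj n
        rw [e] at this
        nlinarith [hlog0 n]
      have hlow : ∀ n, 0 ≤ (j n : ℝ) * Real.log (c n) := fun n =>
        mul_nonneg (Nat.cast_nonneg _) (hlog0 n).le
      have hπα : Tendsto (fun n => Real.pi / |α n|) atTop (𝓝 0) :=
        tendsto_const_nhds.div_atTop hα
      have hjl : Tendsto (fun n => (j n : ℝ) * Real.log (c n)) atTop (𝓝 0) :=
        tendsto_of_tendsto_of_tendsto_of_le_of_le' tendsto_const_nhds hπα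
          (Eventually.of_forall hlow) hb
      have hexp := (Real.continuous_exp.tendsto _).comp hjl
      rw [Real.exp_zero] at hexp
      refine hexp.congr fun n => ?_
      rw [Function.comp_apply, ← Real.log_pow, Real.exp_log (pow_pos (hc0 n) _)]
    have h := h1.mul h2
    rw [mul_one] at h
    refine h.congr fun n => ?_
    rw [pow_add]
  · -- angles: within `|θ n|` of `2π m_n`, and `θ n → 0`
    have hθlim : Tendsto (fun n => |θ n|) atTop (𝓝 0) := by
      have h := (hαc.const_mul 2).abs
      rw [mul_zero, abs_zero] at h
      refine h.congr fun n => ?_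
      rw [hθ]; ring_nf
    refine squeeze_zero_norm (fun n => ?_) hθlim
    rw [Real.norm_eq_abs]
    have e : α n * (2 * Real.log (c n ^ (k₀ n + j n))) = (k₀ n : ℝ) * θ n + j n * θ n := by
      rw [Real.log_pow, hθ]; push_cast; ring
    rw [e]
    exact hm n

end PineauVicol2026

end Literature.Analysis.FluidPDE

end
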